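import Summits.CriticalPhenomena.Ising3DConformalLimit.Theorems.CoerciveSharpnessCoerciveReflectedGradientDefs
import HarnessLib

/-!
# Route `CoerciveSharpness`, crux `CoerciveReflectedGradient` (stmt-CriticalPhenomena-18197), line `base_box_rerun`:
# registered stub `stub_growthSelection`

`theorem stub_growthSelection : Sig.stub_growthSelection` (vocabulary in
`Theorems/CoerciveSharpnessCoerciveReflectedGradientDefs.lean`): the pure real-analysis SCALE SELECTION
closing the base-box rerun of Duminil-Copin–Panis 2025 (arXiv:2404.05700) §2.2. From the line's analytic
output `c m^κ ≤ c m^κ · (C m³ / n) + A · Q(n)` for all `1 ≤ m`, `2m ≤ n`, choosing `m = ⌊(n/(2C))^{1/3}⌋`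
(so that the head `C m³/n ≤ 1/2` while `m ≥ (n/(2C))^{1/3} / 2`) gives
`Q(n) ≥ (c/(2A)) m^κ ≥ c₀ n^{κ/3}` for all large `n`, with `κ' = κ/3` and
`c₀ = (c/(2A)) / ((2C)^{κ/3} 2^κ)`. Helper file (`--supports stmt-CriticalPhenomena-18197`); no
definition, no named fact as hypothesis; Mathlib only (`Real.rpow` and `Nat.floor` bookkeeping).
-/

noncomputable section

namespace Summit.CriticalPhenomena.Ising3DConformalLimit.Cruxes.CoerciveReflectedGradient.BaseBoxRerun

/-- [folklore] The real cube root of `8` is `2`: `8^{1/3} = 2`. -/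
private lemma rpow_eight_one_third : (8 : ℝ) ^ ((1 : ℝ) / 3) = 2 := by
  rw [show (8 : ℝ) = 2 ^ ((3 : ℕ) : ℝ) by rw [Real.rpow_natCast]; norm_num,
    ← Real.rpow_mul (by norm_num : (0 : ℝ) ≤ 2)]
  norm_num

/-- [folklore] Scale selection `m = ⌊t⌋`, `t = (n/(2C))^{1/3}`: once `n ≥ 16 C` (so `t ≥ 2`) and
`n ≥ 4 / C` (so `2t ≤ n`), the natural number `m` satisfies `1 ≤ m`, `2m ≤ n`, the head bound
`C m³ / n ≤ 1/2`, and the lower bound `t / 2 ≤ m`. -/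
private lemma scale_exists {C : ℝ} (hC : 0 < C) {n : ℕ} (h16 : 16 * C ≤ n) (h4 : 4 / C ≤ n) :
    ∃ m : ℕ, 1 ≤ m ∧ 2 * m ≤ n ∧ C * (m : ℝ) ^ 3 / (n : ℝ) ≤ 1 / 2 ∧
      ((n : ℝ) / (2 * C)) ^ ((1 : ℝ) / 3) / 2 ≤ m := by
  set B : ℝ := (n : ℝ) / (2 * C) with hB
  have h2C : (0 : ℝ) < 2 * C := by positivity
  have hB0 : 0 ≤ B := by positivity
  have hB8 : 8 ≤ B := by
    rw [hB, le_div_iff₀ h2C]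
    linarith
  set t : ℝ := B ^ ((1 : ℝ) / 3) with ht
  have ht0 : 0 ≤ t := Real.rpow_nonneg hB0 _
  have ht2 : 2 ≤ t := by
    have h := Real.rpow_le_rpow (by norm_num) hB8 (by norm_num : (0 : ℝ) ≤ (1 : ℝ) / 3)
    rwa [rpow_eight_one_third] at h
  have ht3 : t ^ 3 = B := by
    rw [ht, ← Real.rpow_natCast, ← Real.rpow_mul hB0]
    norm_num
  have hn0 : (0 : ℝ) < n := lt_of_lt_of_le (by positivity) h16
  have hn1 : (1 : ℝ) ≤ n := by
    have h : 0 < n := by exact_mod_cast hn0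
    exact_mod_cast h
  -- `2 t ≤ n`, via cubes: `(2t)³ = 8 B = 4 n / C ≤ n · n ≤ n³`.
  have h2t : 2 * t ≤ n := by
    have h4' : 4 ≤ (n : ℝ) * C := by
      have h := (div_le_iff₀ hC).mp h4
      linarith
    have hcube : (2 * t) ^ 3 ≤ (n : ℝ) ^ 3 := by
      have h8B : (2 * t) ^ 3 = 4 * n / C := by
        rw [mul_pow, ht3, hB]
        field_simp
        ring
      rw [h8B, div_le_iff₀ hC]
      have e1 : (n : ℝ) * 4 ≤ n * (n * C) := mul_le_mul_of_nonneg_left h4' hn0.le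
      have e2 : 0 ≤ (n : ℝ) * (n * C) * (n - 1) := mul_nonneg (by positivity) (by linarith)
      nlinarith [e1, e2]
    exact (pow_le_pow_iff_left₀ (by positivity) hn0.le (by norm_num)).mp hcube
  have hfl : (⌊t⌋₊ : ℝ) ≤ t := Nat.floor_le ht0
  have hfl' : t < ⌊t⌋₊ + 1 := Nat.lt_floor_add_one t
  refine ⟨⌊t⌋₊, ?_, ?_, ?_, ?_⟩
  · exact Nat.le_floor (by rw [Nat.cast_one]; linarith)
  · have h : ((2 * ⌊t⌋₊ : ℕ) : ℝ) ≤ n := by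
      push_cast
      linarith
    exact_mod_cast h
  · have hm3 : (⌊t⌋₊ : ℝ) ^ 3 ≤ B := ht3 ▸ pow_le_pow_left₀ (Nat.cast_nonneg _) hfl 3
    rw [hB, le_div_iff₀ h2C] at hm3
    rw [div_le_iff₀ hn0]
    linarith
  · linarith

/-- [folklore] The algebra of the scale `t = (n/(2C))^{1/3}`:
`(t/2)^κ = n^{κ/3} / ((2C)^{κ/3} · 2^κ)`. -/
private lemma half_scale_rpow {C : ℝ} (hC : 0 < C) (n : ℕ) (κ : ℝ) :
    (((n : ℝ) / (2 * C)) ^ ((1 : ℝ) / 3) / 2) ^ κ =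
      (n : ℝ) ^ (κ / 3) / ((2 * C) ^ (κ / 3) * (2 : ℝ) ^ κ) := by
  have hB0 : 0 ≤ (n : ℝ) / (2 * C) := by positivity
  have ht0 : 0 ≤ ((n : ℝ) / (2 * C)) ^ ((1 : ℝ) / 3) := Real.rpow_nonneg hB0 _
  rw [Real.div_rpow ht0 (by norm_num : (0 : ℝ) ≤ 2), ← Real.rpow_mul hB0,
    Real.div_rpow (Nat.cast_nonneg n) (by positivity : (0 : ℝ) ≤ 2 * C),
    show (1 : ℝ) / 3 * κ = κ / 3 by ring, div_div]

/-- **Stub `stub_growthSelection` (scale selection `m ≍ n^{1/3}`, `κ' = κ/3`).** If `Q : ℕ → ℝ`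
satisfies, for constants `κ, c, C, A > 0`, the inequality
`c m^κ ≤ c m^κ · (C m³ / n) + A · Q(n)` for all naturals `1 ≤ m`, `2m ≤ n`, then
`Q(n) ≥ c₀ n^{κ'}` for all `n ≥ N₀`, with `κ' = κ/3 > 0` and
`c₀ = (c/(2A)) / ((2C)^{κ/3} 2^κ) > 0`. Proof: at `m = ⌊(n/(2C))^{1/3}⌋` (`scale_exists`) the head is
`≤ 1/2`, so `A Q(n) ≥ c m^κ / 2`, and `m ≥ (n/(2C))^{1/3}/2` gives `m^κ ≥ n^{κ/3}/((2C)^{κ/3} 2^κ)`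
(`half_scale_rpow`). -/
theorem stub_growthSelection : Sig.stub_growthSelection := by
  intro Q κ c C A hκ hc hC hA h
  have hD : (0 : ℝ) < (2 * C) ^ (κ / 3) * (2 : ℝ) ^ κ :=
    mul_pos (Real.rpow_pos_of_pos (by positivity) _) (Real.rpow_pos_of_pos (by norm_num) _)
  refine ⟨κ / 3, c / (2 * A) / ((2 * C) ^ (κ / 3) * (2 : ℝ) ^ κ), by positivity,
    div_pos (by positivity) hD, ⌈16 * C⌉₊ + ⌈4 / C⌉₊ + 2, fun n hn => ?_⟩
  -- the threshold: `n ≥ ⌈16C⌉ + ⌈4/C⌉ + 2` gives `16 C ≤ n` and `4/C ≤ n`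
  have hn' : ((⌈16 * C⌉₊ + ⌈4 / C⌉₊ + 2 : ℕ) : ℝ) ≤ n := by exact_mod_cast hn
  push_cast at hn'
  have hc16 : 16 * C ≤ ⌈16 * C⌉₊ := Nat.le_ceil _
  have hc4 : 4 / C ≤ ⌈4 / C⌉₊ := Nat.le_ceil _
  have hC4 : 0 ≤ 4 / C := by positivity
  have h16 : 16 * C ≤ n := by linarith
  have h4 : 4 / C ≤ n := by linarith [hC.le]
  -- the scale `m`
  obtain ⟨m, hm1, hmn, hhead, hmlow⟩ := scale_exists hC h16 h4
  have key := h m n hm1 hmn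
  have hX0 : 0 ≤ c * (m : ℝ) ^ κ := by positivity
  have hXQ : c * (m : ℝ) ^ κ / 2 ≤ A * Q n := by
    have h' : c * (m : ℝ) ^ κ * (C * (m : ℝ) ^ 3 / (n : ℝ)) ≤ c * (m : ℝ) ^ κ * (1 / 2) :=
      mul_le_mul_of_nonneg_left hhead hX0
    linarith
  have hQ : c / (2 * A) * (m : ℝ) ^ κ ≤ Q n := by
    have h' : c * (m : ℝ) ^ κ / (2 * A) ≤ Q n := by
      rw [div_le_iff₀ (by positivity)]
      linarith
    calc c / (2 * A) * (m : ℝ) ^ κ = c * (m : ℝ) ^ κ / (2 * A) := by ring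
      _ ≤ Q n := h'
  -- the lower bound `m^κ ≥ (t/2)^κ = n^{κ/3} / ((2C)^{κ/3} 2^κ)`
  have ht2 : 0 ≤ ((n : ℝ) / (2 * C)) ^ ((1 : ℝ) / 3) / 2 :=
    div_nonneg (Real.rpow_nonneg (by positivity) _) (by norm_num)
  have hmk : (((n : ℝ) / (2 * C)) ^ ((1 : ℝ) / 3) / 2) ^ κ ≤ (m : ℝ) ^ κ :=
    Real.rpow_le_rpow ht2 hmlow hκ.le
  rw [half_scale_rpow hC n κ] at hmk
  calc c / (2 * A) / ((2 * C) ^ (κ / 3) * (2 : ℝ) ^ κ) * (n : ℝ) ^ (κ / 3)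
        = c / (2 * A) * ((n : ℝ) ^ (κ / 3) / ((2 * C) ^ (κ / 3) * (2 : ℝ) ^ κ)) := by
          rw [div_mul_eq_mul_div, mul_div_assoc]
    _ ≤ c / (2 * A) * (m : ℝ) ^ κ := by gcongr
    _ ≤ Q n := hQ

end Summit.CriticalPhenomena.Ising3DConformalLimit.Cruxes.CoerciveReflectedGradient.BaseBoxRerun

end
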